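import Mathlib
import Summits.NavierStokesRegularity.NavierStokesRegularity.Theorems.EulerZoomLiouvillePowerGaugeEulerLiouvilleDSSNodeSpectralRates
import HarnessLib.Audit

/-!
# Crux E `PowerGaugeEulerLiouville` (stmt-NavierStokesRegularity-19832): THE DOMINATED SPLITTING OF A POWER — an operator on `ℝ³` with an
# expanding eigenvector `Mω = λ₀ω` (`λ₀ > 1`) and `0 < det M < λ₀` contracts a nontrivial invariant subspace, dominated by its complement
# (width seat ns-cas-k2 g3, lane «DSS thin vortical nodes», tool A′ part 3 = assembly)

Route `EulerZoomLiouville` (NavierStokesRegularity), crux E.  Assembly of `…DSSNodeSpectralSplitting` (cofactor `X² + uX + w`, `wλ₀ = det M`, Bezout)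
and `…DSSNodeSpectralRates` (rates of `M^k`): since `0 < w = det M/λ₀ < 1`, the cofactor has a root of modulus `< 1`, and in each of the
spectral cases — complex pair (`u² < 4w`), double root (`u² = 4w`), distinct real roots (`u² > 4w`; sub-cases `r_b ≠ λ₀` / `r_b = λ₀`) — some power
`M^k` contracts the corresponding invariant subspace `Es ≠ ⊥` at a rate `a < 1` strictly below the lower rate `b` of the complementary invariant
subspace `Ec`:
* `exists_splitting_of_complexPair`, `exists_splitting_of_doubleRoot`, `exists_splitting_of_distinctRoots` — the three cases;
* **`exists_dominatedSplitting_pow`** — `Mω = λ₀ω` (`ω ≠ 0`), `1 < λ₀`, `0 < det M < λ₀` ⇒ `∃ Es Ec k a b`, `IsCompl Es Ec`, both `M`-invariant, `Ec ≠ ⊤`,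
  `k ≥ 1`, `a < 1`, `a < b`, `‖M^k x‖ ≤ a‖x‖` on `Es`, `b‖x‖ ≤ ‖M^k x‖` on `Ec` — verbatim the hypothesis of
  `DSSNodes.addHaar_pastHistorySet_eq_zero_of_dominated_pow` (…DSSNodeIterateSplitting).
Consumer: the rescaled DSS period map at a vortical permanent node (`λ₀ = lT`, `det = l³`, window `ρ > 0`).

WHAT THIS IS NOT: not NS regularity, not the crux E — finite-dimensional linear algebra for hypothetical DSS blow-up members; 19832 is OPEN.
[folklore; Robinson1999 Ch. V §5.10.1 (dominated splittings)]
-/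

noncomputable section

set_option linter.dupNamespace false

open Set Filter Topology Function
open scoped RealInnerProductSpace

namespace Summit.NavierStokesRegularity.NavierStokesRegularity.Theorems.PowerGaugeEulerLiouville.DSSNodes

/-! ### Small tools -/

/-- A real sequence tending to `0` is eventually `< 1`, at some index `≥ 1`. [folklore] -/
theorem exists_ge_one_lt_one_of_tendsto {f : ℕ → ℝ} (hf : Tendsto f atTop (𝓝 0)) : ∃ k : ℕ, 1 ≤ k ∧ f k < 1 := by
  obtain ⟨k, hk1, hk2⟩ := ((eventually_ge_atTop 1).and (hf.eventually (gt_mem_nhds one_pos))).exists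
  exact ⟨k, hk1, hk2⟩

/-- `(k+1)·θ^k → 0` and `θ^{k+1} → 0` packaged: for `0 ≤ θ < 1` and constants `A, B`, `A·θ^(k+1) + B·(k+1)·θ^k → 0`. [folklore] -/
theorem tendsto_geom_poly {θ : ℝ} (h0 : 0 ≤ θ) (h1 : θ < 1) (A B : ℝ) :
    Tendsto (fun k : ℕ => A * θ ^ (k + 1) + B * (((k : ℝ) + 1) * θ ^ k)) atTop (𝓝 0) := by
  have hθ : |θ| < 1 := by rwa [abs_of_nonneg h0]
  have hp : Tendsto (fun k : ℕ => θ ^ k) atTop (𝓝 0) := tendsto_pow_atTop_nhds_zero_of_lt_one h0 h1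
  have hp1 : Tendsto (fun k : ℕ => θ ^ (k + 1)) atTop (𝓝 0) := hp.comp (tendsto_add_atTop_nat 1)
  have hk : Tendsto (fun k : ℕ => (k : ℝ) * θ ^ k) atTop (𝓝 0) := tendsto_self_mul_const_pow_of_abs_lt_one hθ
  have hsum : Tendsto (fun k : ℕ => ((k : ℝ) + 1) * θ ^ k) atTop (𝓝 0) := by
    have h := hk.add hp
    rw [add_zero] at h
    refine h.congr fun k => ?_
    ring
  have h := (hp1.const_mul A).add (hsum.const_mul B)
  simpa using h

/-- An operator on `ℝ³` equal to `λ₀·id` has determinant `λ₀³`. [folklore] -/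
theorem det_eq_pow_three_of_forall_eq_smul (M : EuclideanSpace ℝ (Fin 3) →L[ℝ] EuclideanSpace ℝ (Fin 3)) {lam₀ : ℝ}
    (h : ∀ x, M x = lam₀ • x) : M.det = lam₀ ^ 3 := by
  have hM : M = lam₀ • ContinuousLinearMap.id ℝ (EuclideanSpace ℝ (Fin 3)) := by
    ext x; simp [h x]
  rw [hM, ContinuousLinearMap.det, ContinuousLinearMap.toLinearMap_smul, ContinuousLinearMap.coe_id, LinearMap.det_smul,
    LinearMap.det_id, finrank_euclideanSpace_fin]
  simp

/-- On `ker (M − λ)`: `‖M^k x‖ = |λ|^k ‖x‖`. [folklore] -/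
theorem norm_pow_of_mem_ker_linear (M : EuclideanSpace ℝ (Fin 3) →L[ℝ] EuclideanSpace ℝ (Fin 3)) {lam : ℝ}
    {x : EuclideanSpace ℝ (Fin 3)}
    (hx : x ∈ LinearMap.ker ((M - lam • ContinuousLinearMap.id ℝ (EuclideanSpace ℝ (Fin 3)) :
        EuclideanSpace ℝ (Fin 3) →L[ℝ] EuclideanSpace ℝ (Fin 3)) : EuclideanSpace ℝ (Fin 3) →ₗ[ℝ] EuclideanSpace ℝ (Fin 3)))
    (k : ℕ) : ‖(M ^ k) x‖ = |lam| ^ k * ‖x‖ := by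
  rw [pow_apply_of_eigen M ((mem_ker_linear_iff M lam x).1 hx) k, norm_smul, Real.norm_eq_abs, abs_pow]

/-- From `IsCompl Es Ec` and `Es ≠ ⊥`: `Ec ≠ ⊤`. [folklore] -/
theorem ne_top_of_isCompl_of_ne_bot {Es Ec : Submodule ℝ (EuclideanSpace ℝ (Fin 3))} (h : IsCompl Es Ec) (hEs : Es ≠ ⊥) :
    Ec ≠ ⊤ := by
  intro htop
  apply hEs
  have := h.inf_eq_bot
  rwa [htop, inf_top_eq] at this

/-! ### Case 1: complex pair -/

/-- **COMPLEX PAIR.**  `u² < 4w`, `w < 1`, `1 < λ₀`, `det M < λ₀`, `wλ₀ = det M`, `(M − λ₀)(M² + uM + w) = 0` ⇒ dominated splitting of a power with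
`Es = ker(M² + uM + w)`, `Ec = ker(M − λ₀)`. [folklore] -/
theorem exists_splitting_of_complexPair (M : EuclideanSpace ℝ (Fin 3) →L[ℝ] EuclideanSpace ℝ (Fin 3)) {lam₀ u w : ℝ}
    (hlam : 1 < lam₀) (hdet : M.det < lam₀) (hw1 : w < 1)
    (hzero : ∀ x, M (M (M x) + u • M x + w • x) - lam₀ • (M (M x) + u • M x + w • x) = 0) (hC : u ^ 2 < 4 * w) :
    ∃ (Es Ec : Submodule ℝ (EuclideanSpace ℝ (Fin 3))) (k : ℕ) (a b : ℝ), IsCompl Es Ec ∧ (∀ x ∈ Es, M x ∈ Es) ∧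
      (∀ x ∈ Ec, M x ∈ Ec) ∧ Ec ≠ ⊤ ∧ 0 < k ∧ a < 1 ∧ a < b ∧ (∀ x ∈ Es, ‖(M ^ k) x‖ ≤ a * ‖x‖) ∧
      (∀ x ∈ Ec, b * ‖x‖ ≤ ‖(M ^ k) x‖) := by
  have hw0 : 0 < w := by nlinarith [sq_nonneg u]
  have hc : lam₀ ^ 2 + u * lam₀ + w ≠ 0 := by nlinarith [sq_nonneg (lam₀ + u / 2)]
  have hcompl := isCompl_ker_quadratic_ker_linear M u w lam₀ hzero hc
  set Es := LinearMap.ker ((M.comp M + u • M + w • ContinuousLinearMap.id ℝ (EuclideanSpace ℝ (Fin 3)) :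
        EuclideanSpace ℝ (Fin 3) →L[ℝ] EuclideanSpace ℝ (Fin 3)) : EuclideanSpace ℝ (Fin 3) →ₗ[ℝ] EuclideanSpace ℝ (Fin 3))
    with hEs
  set Ec := LinearMap.ker ((M - lam₀ • ContinuousLinearMap.id ℝ (EuclideanSpace ℝ (Fin 3)) :
        EuclideanSpace ℝ (Fin 3) →L[ℝ] EuclideanSpace ℝ (Fin 3)) : EuclideanSpace ℝ (Fin 3) →ₗ[ℝ] EuclideanSpace ℝ (Fin 3))
    with hEc
  -- `Es ≠ ⊥`: otherwise `M = λ₀·id` and `det M = λ₀³ ≥ λ₀`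
  have hEsne : Es ≠ ⊥ := by
    intro hbot
    have htop : Ec = ⊤ := by
      have h := hcompl.sup_eq_top
      rwa [hbot, bot_sup_eq] at h
    have hall : ∀ x, M x = lam₀ • x := fun x =>
      (mem_ker_linear_iff M lam₀ x).1 (by rw [← hEc, htop]; exact Submodule.mem_top)
    have hd := det_eq_pow_three_of_forall_eq_smul M hall
    have h1 : 1 ≤ lam₀ ^ 2 := one_le_pow₀ hlam.le
    have : lam₀ ≤ lam₀ ^ 3 := by nlinarith
    linarith
  -- rates
  set θ : ℝ := Real.sqrt w with hθ
  have hθ0 : 0 ≤ θ := Real.sqrt_nonneg w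
  have hθ1 : θ < 1 := by rw [hθ, Real.sqrt_lt' one_pos]; simpa using hw1
  set C₁ : ℝ := Real.sqrt (1 + (‖M‖ + |u| / 2) ^ 2 / (w - u ^ 2 / 4)) with hC₁
  have hlim : Tendsto (fun k : ℕ => C₁ * θ ^ k) atTop (𝓝 0) := by
    simpa using (tendsto_pow_atTop_nhds_zero_of_lt_one hθ0 hθ1).const_mul C₁
  obtain ⟨k, hk1, hk⟩ := exists_ge_one_lt_one_of_tendsto hlim
  have hb1 : 1 ≤ lam₀ ^ k := one_le_pow₀ hlam.le
  refine ⟨Es, Ec, k, C₁ * θ ^ k, lam₀ ^ k, hcompl, fun x hx => mem_ker_quadratic_of_mem M u w hx,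
    fun x hx => mem_ker_linear_of_mem M lam₀ hx, ne_top_of_isCompl_of_ne_bot hcompl hEsne, hk1, hk, by linarith,
    fun x hx => ?_, fun x hx => ?_⟩
  · exact norm_pow_le_of_complexPair M hC ((mem_ker_quadratic_iff M u w x).1 hx) k
  · rw [norm_pow_of_mem_ker_linear M hx k, abs_of_pos (by linarith : (0 : ℝ) < lam₀)]

/-! ### Case 2: double root -/

/-- **DOUBLE ROOT.**  `u² = 4w`, `0 < w < 1`, `1 < λ₀`, `det M < λ₀`, `(M − λ₀)(M² + uM + w) = 0` ⇒ dominated splitting of a power with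
`Es = ker (M + u/2)² = ker(M² + uM + w)`, `Ec = ker(M − λ₀)`. [folklore] -/
theorem exists_splitting_of_doubleRoot (M : EuclideanSpace ℝ (Fin 3) →L[ℝ] EuclideanSpace ℝ (Fin 3)) {lam₀ u w : ℝ}
    (hlam : 1 < lam₀) (hdet : M.det < lam₀) (hw0 : 0 < w) (hw1 : w < 1)
    (hzero : ∀ x, M (M (M x) + u • M x + w • x) - lam₀ • (M (M x) + u • M x + w • x) = 0) (hD : u ^ 2 = 4 * w) :
    ∃ (Es Ec : Submodule ℝ (EuclideanSpace ℝ (Fin 3))) (k : ℕ) (a b : ℝ), IsCompl Es Ec ∧ (∀ x ∈ Es, M x ∈ Es) ∧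
      (∀ x ∈ Ec, M x ∈ Ec) ∧ Ec ≠ ⊤ ∧ 0 < k ∧ a < 1 ∧ a < b ∧ (∀ x ∈ Es, ‖(M ^ k) x‖ ≤ a * ‖x‖) ∧
      (∀ x ∈ Ec, b * ‖x‖ ≤ ‖(M ^ k) x‖) := by
  set r : ℝ := -(u / 2) with hr
  have hu : u = -(2 * r) := by rw [hr]; ring
  have hw : w = r ^ 2 := by rw [hr]; nlinarith
  have hrabs : |r| < 1 := by
    have h1 : |r| ^ 2 < 1 := by rw [sq_abs, ← hw]; exact hw1
    nlinarith [abs_nonneg r]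
  have hc : lam₀ ^ 2 + u * lam₀ + w ≠ 0 := by
    rw [hu, hw]
    have : lam₀ - r ≠ 0 := by
      have : r ≤ |r| := le_abs_self r
      intro h; linarith
    have e : lam₀ ^ 2 + -(2 * r) * lam₀ + r ^ 2 = (lam₀ - r) ^ 2 := by ring
    rw [e]; exact pow_ne_zero 2 this
  have hcompl := isCompl_ker_quadratic_ker_linear M u w lam₀ hzero hc
  set Es := LinearMap.ker ((M.comp M + u • M + w • ContinuousLinearMap.id ℝ (EuclideanSpace ℝ (Fin 3)) :
        EuclideanSpace ℝ (Fin 3) →L[ℝ] EuclideanSpace ℝ (Fin 3)) : EuclideanSpace ℝ (Fin 3) →ₗ[ℝ] EuclideanSpace ℝ (Fin 3))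
    with hEs
  set Ec := LinearMap.ker ((M - lam₀ • ContinuousLinearMap.id ℝ (EuclideanSpace ℝ (Fin 3)) :
        EuclideanSpace ℝ (Fin 3) →L[ℝ] EuclideanSpace ℝ (Fin 3)) : EuclideanSpace ℝ (Fin 3) →ₗ[ℝ] EuclideanSpace ℝ (Fin 3))
    with hEc
  have hEsne : Es ≠ ⊥ := by
    intro hbot
    have htop : Ec = ⊤ := by
      have h := hcompl.sup_eq_top
      rwa [hbot, bot_sup_eq] at h
    have hall : ∀ x, M x = lam₀ • x := fun x =>
      (mem_ker_linear_iff M lam₀ x).1 (by rw [← hEc, htop]; exact Submodule.mem_top)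
    have hd := det_eq_pow_three_of_forall_eq_smul M hall
    have h1 : 1 ≤ lam₀ ^ 2 := one_le_pow₀ hlam.le
    have : lam₀ ≤ lam₀ ^ 3 := by nlinarith
    linarith
  -- the double-root equation on `Es`
  have hEq : ∀ x ∈ Es, M (M x) + (-(2 * r)) • M x + r ^ 2 • x = 0 := by
    intro x hx
    have h := (mem_ker_quadratic_iff M u w x).1 hx
    rwa [hu, hw] at h
  -- rates
  have hlim : Tendsto (fun k : ℕ => |r| ^ (k + 1) + ((k : ℝ) + 1) * |r| ^ k * (‖M‖ + |r|)) atTop (𝓝 0) := by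
    have h := tendsto_geom_poly (abs_nonneg r) hrabs 1 (‖M‖ + |r|)
    refine h.congr fun k => ?_
    ring
  obtain ⟨k, -, hk⟩ := exists_ge_one_lt_one_of_tendsto hlim
  have hb1 : 1 ≤ lam₀ ^ (k + 1) := one_le_pow₀ hlam.le
  refine ⟨Es, Ec, k + 1, |r| ^ (k + 1) + ((k : ℝ) + 1) * |r| ^ k * (‖M‖ + |r|), lam₀ ^ (k + 1), hcompl,
    fun x hx => mem_ker_quadratic_of_mem M u w hx, fun x hx => mem_ker_linear_of_mem M lam₀ hx,
    ne_top_of_isCompl_of_ne_bot hcompl hEsne, Nat.succ_pos k, hk, by linarith, fun x hx => ?_, fun x hx => ?_⟩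
  · exact norm_pow_le_of_doubleRoot M (hEq x hx) k
  · rw [norm_pow_of_mem_ker_linear M hx (k + 1), abs_of_pos (by linarith : (0 : ℝ) < lam₀)]

/-! ### Case 3: distinct real roots -/

/-- **DISTINCT REAL ROOTS** `r_s ≠ r_b` of the cofactor (`r_s + r_b = −u`, `r_s r_b = w`) with `|r_s| < |r_b|`, `|r_s| < 1`, `1 < λ₀`:
dominated splitting of a power with `Es = ker(M − r_s)`, `Ec = ker (M − r_b)(M − λ₀)` (Lagrange idempotents if `r_b ≠ λ₀`, nilpotent
bookkeeping if `r_b = λ₀`). [folklore] -/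
theorem exists_splitting_of_distinctRoots (M : EuclideanSpace ℝ (Fin 3) →L[ℝ] EuclideanSpace ℝ (Fin 3)) {lam₀ u w : ℝ}
    (hlam : 1 < lam₀)
    (hzero : ∀ x, M (M (M x) + u • M x + w • x) - lam₀ • (M (M x) + u • M x + w • x) = 0)
    (hroots : ∀ r : ℝ, r ^ 2 + u * r + w = 0 → ∃ v : EuclideanSpace ℝ (Fin 3), v ≠ 0 ∧ M v = r • v)
    {rs rb : ℝ} (hsum : rs + rb = -u) (hprod : rs * rb = w) (hne : rs ≠ rb) (hmod : |rs| < |rb|) (hs1 : |rs| < 1) :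
    ∃ (Es Ec : Submodule ℝ (EuclideanSpace ℝ (Fin 3))) (k : ℕ) (a b : ℝ), IsCompl Es Ec ∧ (∀ x ∈ Es, M x ∈ Es) ∧
      (∀ x ∈ Ec, M x ∈ Ec) ∧ Ec ≠ ⊤ ∧ 0 < k ∧ a < 1 ∧ a < b ∧ (∀ x ∈ Es, ‖(M ^ k) x‖ ≤ a * ‖x‖) ∧
      (∀ x ∈ Ec, b * ‖x‖ ≤ ‖(M ^ k) x‖) := by
  have hu : u = -(rs + rb) := by linarith
  have hw : w = rs * rb := hprod.symm
  have hlam0 : 0 < lam₀ := by linarith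
  have hslam : rs ≠ lam₀ := by
    have : rs ≤ |rs| := le_abs_self rs
    intro h; linarith
  -- eigenvector for `r_s`
  obtain ⟨vs, hvs0, hvs⟩ := hroots rs (by rw [hu, hw]; ring)
  set Es := LinearMap.ker ((M - rs • ContinuousLinearMap.id ℝ (EuclideanSpace ℝ (Fin 3)) :
        EuclideanSpace ℝ (Fin 3) →L[ℝ] EuclideanSpace ℝ (Fin 3)) : EuclideanSpace ℝ (Fin 3) →ₗ[ℝ] EuclideanSpace ℝ (Fin 3))
    with hEs
  set Ec := LinearMap.ker ((M.comp M + (-(rb + lam₀)) • M + (rb * lam₀) • ContinuousLinearMap.id ℝ (EuclideanSpace ℝ (Fin 3)) :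
        EuclideanSpace ℝ (Fin 3) →L[ℝ] EuclideanSpace ℝ (Fin 3)) : EuclideanSpace ℝ (Fin 3) →ₗ[ℝ] EuclideanSpace ℝ (Fin 3))
    with hEc
  -- `(M − r_s) ∘ (M − r_b)(M − λ₀) = (M − λ₀)(M² + uM + w) = 0`
  have hzero' : ∀ x, M (M (M x) + (-(rb + lam₀)) • M x + (rb * lam₀) • x) -
      rs • (M (M x) + (-(rb + lam₀)) • M x + (rb * lam₀) • x) = 0 := by
    intro x
    have h := hzero x
    rw [hu, hw] at h
    have e : M (M (M x) + (-(rb + lam₀)) • M x + (rb * lam₀) • x) - rs • (M (M x) + (-(rb + lam₀)) • M x + (rb * lam₀) • x) =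
        M (M (M x) + (-(rs + rb)) • M x + (rs * rb) • x) - lam₀ • (M (M x) + (-(rs + rb)) • M x + (rs * rb) • x) := by
      simp only [map_add, map_smul]
      module
    rw [e]; exact h
  have hc : rs ^ 2 + (-(rb + lam₀)) * rs + rb * lam₀ ≠ 0 := by
    have e : rs ^ 2 + (-(rb + lam₀)) * rs + rb * lam₀ = (rs - rb) * (rs - lam₀) := by ring
    rw [e]; exact mul_ne_zero (sub_ne_zero.2 hne) (sub_ne_zero.2 hslam)
  have hcompl : IsCompl Es Ec := (isCompl_ker_quadratic_ker_linear M (-(rb + lam₀)) (rb * lam₀) rs hzero' hc).symm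
  have hEsne : Es ≠ ⊥ := by
    rw [Submodule.ne_bot_iff]
    exact ⟨vs, (mem_ker_linear_iff M rs vs).2 hvs, hvs0⟩
  have hEcne : Ec ≠ ⊤ := ne_top_of_isCompl_of_ne_bot hcompl hEsne
  have hinvEs : ∀ x ∈ Es, M x ∈ Es := fun x hx => mem_ker_linear_of_mem M rs hx
  have hinvEc : ∀ x ∈ Ec, M x ∈ Ec := fun x hx => mem_ker_quadratic_of_mem M (-(rb + lam₀)) (rb * lam₀) hx
  have hconEs : ∀ k : ℕ, ∀ x ∈ Es, ‖(M ^ k) x‖ ≤ |rs| ^ k * ‖x‖ := fun k x hx => (norm_pow_of_mem_ker_linear M hx k).le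
  by_cases hbl : rb = lam₀
  · -- `r_b = λ₀`: `Ec = ker (M − λ₀)²`
    have hEq : ∀ x ∈ Ec, M (M x) + (-(2 * lam₀)) • M x + lam₀ ^ 2 • x = 0 := by
      intro x hx
      have h := (mem_ker_quadratic_iff M (-(rb + lam₀)) (rb * lam₀) x).1 hx
      rw [hbl] at h
      have e1 : -(lam₀ + lam₀) = -(2 * lam₀) := by ring
      have e2 : lam₀ * lam₀ = lam₀ ^ 2 := by ring
      rwa [e1, e2] at h
    set θ : ℝ := |rs| / lam₀ with hθ
    have hθ0 : 0 ≤ θ := div_nonneg (abs_nonneg _) hlam0.le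
    have hθ1 : θ < 1 := by rw [hθ, div_lt_one hlam0]; linarith
    set c₀ : ℝ := ‖M‖ / lam₀ + 1 with hc₀
    have hlim : Tendsto (fun k : ℕ => θ ^ (k + 1) * (1 + ((k : ℝ) + 1) * c₀)) atTop (𝓝 0) := by
      have h := tendsto_geom_poly hθ0 hθ1 1 (c₀ * θ)
      refine h.congr fun k => ?_
      rw [pow_succ]; ring
    obtain ⟨k, -, hk⟩ := exists_ge_one_lt_one_of_tendsto hlim
    set D : ℝ := 1 + ((k : ℝ) + 1) * c₀ with hD
    have hD0 : 0 < D := by rw [hD, hc₀]; positivity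
    have hlamk : 0 < lam₀ ^ (k + 1) := pow_pos hlam0 _
    refine ⟨Es, Ec, k + 1, |rs| ^ (k + 1), lam₀ ^ (k + 1) / D, hcompl, hinvEs, hinvEc, hEcne, Nat.succ_pos k,
      pow_lt_one₀ (abs_nonneg _) hs1 (Nat.succ_ne_zero k), ?_, hconEs (k + 1), fun x hx => ?_⟩
    · -- `|r_s|^{k+1} < λ₀^{k+1}/D` from `θ^{k+1}·D < 1`
      rw [lt_div_iff₀ hD0]
      have e : |rs| ^ (k + 1) = θ ^ (k + 1) * lam₀ ^ (k + 1) := by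
        rw [hθ, div_pow, div_mul_cancel₀ _ hlamk.ne']
      rw [e]
      have h2 : θ ^ (k + 1) * D < 1 := hk
      nlinarith
    · rw [div_mul_eq_mul_div, div_le_iff₀ hD0]
      have h := le_norm_pow_of_doubleRoot M hlam0 (hEq x hx) k
      rw [← hc₀, ← hD] at h
      linarith
  · -- `r_b ≠ λ₀`: Lagrange idempotents
    set m : ℝ := min |rb| |lam₀| with hm
    have hmpos : |rs| < m := lt_min hmod (by rw [abs_of_pos hlam0]; linarith)
    have hm0 : 0 < m := lt_of_le_of_lt (abs_nonneg rs) hmpos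
    set C : ℝ := |lam₀ - rb|⁻¹ * (‖M‖ + |lam₀| + |rb|) with hC
    have hC0 : 0 < C := by
      rw [hC]
      have h1 : 0 < |lam₀ - rb| := abs_pos.2 (sub_ne_zero.2 (Ne.symm hbl))
      have h2 : 0 < ‖M‖ + |lam₀| + |rb| := by
        have := abs_pos.2 hlam0.ne'; positivity
      positivity
    set θ : ℝ := |rs| / m with hθ
    have hθ0 : 0 ≤ θ := div_nonneg (abs_nonneg _) hm0.le
    have hθ1 : θ < 1 := by rwa [hθ, div_lt_one hm0]
    have hlim : Tendsto (fun k : ℕ => 2 * C * θ ^ k) atTop (𝓝 0) := by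
      simpa using (tendsto_pow_atTop_nhds_zero_of_lt_one hθ0 hθ1).const_mul (2 * C)
    obtain ⟨k, hk1, hk⟩ := exists_ge_one_lt_one_of_tendsto hlim
    have hmk : 0 < m ^ k := pow_pos hm0 k
    refine ⟨Es, Ec, k, |rs| ^ k, m ^ k / (2 * C), hcompl, hinvEs, hinvEc, hEcne, hk1,
      pow_lt_one₀ (abs_nonneg _) hs1 (by omega), ?_, hconEs k, fun x hx => ?_⟩
    · rw [lt_div_iff₀ (by positivity)]
      have e : |rs| ^ k = θ ^ k * m ^ k := by
        rw [hθ, div_pow, div_mul_cancel₀ _ hmk.ne']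
      rw [e]
      nlinarith
    · rw [div_mul_eq_mul_div, div_le_iff₀ (by positivity)]
      have h := le_norm_pow_of_distinctRoots M hbl ((mem_ker_quadratic_iff M (-(rb + lam₀)) (rb * lam₀) x).1 hx) k
      rw [← hm, ← hC] at h
      linarith

/-! ### Assembly -/

/-- **THE DOMINATED SPLITTING OF A POWER.**  Let `M` be an operator on `ℝ³` with an eigenvector `Mω = λ₀ω` (`ω ≠ 0`), `λ₀ > 1`, and
`0 < det M < λ₀`.  Then there are complementary `M`-invariant subspaces `Es`, `Ec` with `Ec ≠ ⊤`, an exponent `k ≥ 1` and rates `a < 1`,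
`a < b` such that `‖M^k x‖ ≤ a‖x‖` for `x ∈ Es` and `b‖x‖ ≤ ‖M^k x‖` for `x ∈ Ec`.  (The cofactor `X² + uX + w` of `λ₀` in `χ_M` has
`0 < w = det M/λ₀ < 1`, hence a root of modulus `< 1`; the three spectral cases are `exists_splitting_of_complexPair/doubleRoot/distinctRoots`.)
At a vortical permanent node of a DSS member in the window, `M = DF(x*)`, `λ₀ = lT`, `det M = l³`. [folklore] -/
theorem exists_dominatedSplitting_pow (M : EuclideanSpace ℝ (Fin 3) →L[ℝ] EuclideanSpace ℝ (Fin 3))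
    {om : EuclideanSpace ℝ (Fin 3)} (hom : om ≠ 0) {lam₀ : ℝ} (hMom : M om = lam₀ • om) (hlam : 1 < lam₀)
    (hdet0 : 0 < M.det) (hdet : M.det < lam₀) :
    ∃ (Es Ec : Submodule ℝ (EuclideanSpace ℝ (Fin 3))) (k : ℕ) (a b : ℝ), IsCompl Es Ec ∧ (∀ x ∈ Es, M x ∈ Es) ∧
      (∀ x ∈ Ec, M x ∈ Ec) ∧ Ec ≠ ⊤ ∧ 0 < k ∧ a < 1 ∧ a < b ∧ (∀ x ∈ Es, ‖(M ^ k) x‖ ≤ a * ‖x‖) ∧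
      (∀ x ∈ Ec, b * ‖x‖ ≤ ‖(M ^ k) x‖) := by
  obtain ⟨u, w, hop, hroots, hwdet⟩ := exists_quadraticCofactor_det M hom hMom
  have hlam0 : 0 < lam₀ := by linarith
  have hweq : w = M.det / lam₀ := by field_simp; linarith
  have hw0 : 0 < w := by rw [hweq]; exact div_pos hdet0 hlam0
  have hw1 : w < 1 := by rw [hweq, div_lt_one hlam0]; exact hdet
  have hzero : ∀ x, M (M (M x) + u • M x + w • x) - lam₀ • (M (M x) + u • M x + w • x) = 0 :=
    fun x => sub_eq_zero.2 (hop x)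
  rcases lt_trichotomy (u ^ 2) (4 * w) with hC | hD | hR
  · exact exists_splitting_of_complexPair M hlam hdet hw1 hzero hC
  · exact exists_splitting_of_doubleRoot M hlam hdet hw0 hw1 hzero hD
  · -- distinct real roots `(−u ± s)/2`, `s = √(u² − 4w) > 0`, of the same sign (product `w > 0`)
    set s : ℝ := Real.sqrt (u ^ 2 - 4 * w) with hs
    have hs0 : 0 < s := Real.sqrt_pos.2 (by linarith)
    have hss : s * s = u ^ 2 - 4 * w := Real.mul_self_sqrt (by linarith)
    have hsu : s < |u| := by
      by_contra h
      push Not at h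
      have h1 : |u| * |u| ≤ s * s := mul_le_mul h h (abs_nonneg u) hs0.le
      have h2 : |u| * |u| = u ^ 2 := by rw [← sq, sq_abs]
      nlinarith
    rcases lt_or_gt_of_ne (show u ≠ 0 by intro h; rw [h] at hR; nlinarith) with hun | hup
    · -- `u < 0`: roots positive, `r_s = (−u − s)/2 < r_b = (−u + s)/2`
      have hua : |u| = -u := abs_of_neg hun
      refine exists_splitting_of_distinctRoots M hlam hzero hroots (rs := (-u - s) / 2) (rb := (-u + s) / 2)
        (by ring) (by nlinarith) (by intro h; linarith) ?_ ?_
      · rw [abs_of_pos (by linarith), abs_of_pos (by linarith)]; linarith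
      · rw [abs_of_pos (by linarith)]
        -- `r_s² < r_s r_b = w < 1` and `0 < r_s`
        have hrs0 : 0 < (-u - s) / 2 := by linarith
        have hprod : (-u - s) / 2 * ((-u + s) / 2) = w := by nlinarith
        have hlt : (-u - s) / 2 < (-u + s) / 2 := by linarith
        nlinarith
    · -- `u > 0`: roots negative, `r_s = (−u + s)/2`, `r_b = (−u − s)/2`
      have hua : |u| = u := abs_of_pos hup
      refine exists_splitting_of_distinctRoots M hlam hzero hroots (rs := (-u + s) / 2) (rb := (-u - s) / 2)
        (by ring) (by nlinarith) (by intro h; linarith) ?_ ?_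
      · rw [abs_of_neg (by linarith), abs_of_neg (by linarith)]; linarith
      · rw [abs_of_neg (by linarith)]
        have hrs0 : 0 < -((-u + s) / 2) := by linarith
        have hprod : (-u + s) / 2 * ((-u - s) / 2) = w := by nlinarith
        nlinarith

end Summit.NavierStokesRegularity.NavierStokesRegularity.Theorems.PowerGaugeEulerLiouville.DSSNodes

end
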